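/-
Copyright (c) 2026. All rights reserved.
Released under Apache 2.0 license as described in the file LICENSE.
-/
import Literature.AlgebraicGeometry.CossartPiltant200819.TameLayers2008
import Literature.AlgebraicGeometry.CossartPiltant200819.TameDescent2008
import HarnessLib

/-!
# Cossart–Piltant 2008, Proposition 9.5 from Corollary 6.3, Proposition 9.3 and Lemma 9.4

The bookkeeping of the printed proof of [CossartPiltant2008] Prop 9.5 (HAL p. 30–31; journal
Prop 9.3), PROVED with Cor 6.3 (`ClimbToInertiaField`), Prop 9.3 (`DescentBelowInertiaField`)
and Lemma 9.4 (`TamePrimeDescent`) as hypotheses: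

* `descentBelowRamificationField_of_leaves :
    ClimbToInertiaField → DescentBelowInertiaField → TamePrimeDescent →
      DescentBelowRamificationField`;
* corollaries: `reductionToArtinSchreier_of_leaves'` and `lu3DiffFinite_of_leaves'` (HAL
  Thm 7.2's reduction, resp. `LU3DiffFinite`, from Cor 6.3, Prop 8.3, Prop 9.3, Lemma 9.4
  [+ Prop 5.1, CP-II] — `TameLayers2008` with Prop 9.5 assembled here), and
  `descentBelowRamificationField_of_viaStableModel` (Prop 9.5 with the tame step read as
  printed: `TamePrimeDescentViaStableModel` + the stability hypothesis (S3\*) of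
  `TameDescent2008`).

The printed proof: for `K ⊆ K' ⊆ Kʳ` with `V' = W ∩ K'` locally uniformizable, (1) `K″ := K'Kⁱ`
lies below the inertia field of `W` over `V'`, so `W ∩ K″` is locally uniformizable (Cor 6.3
over `K'`); (2) `Kⁱ ⊆ K″ ⊆ Kʳ` and `Kʳ/Kⁱ` is abelian of order prime to `p` ((8), HAL p. 6), so
`K″/Kⁱ` is a tower of Galois extensions of prime degrees `l ≠ p` and Lemma 9.4 descends local
uniformization to `Kⁱ`; (3) Prop 9.3 descends it to `K`.

Ingredients proved here (all [folklore] / Zariski–Samuel VI §12):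
* `chi_pow`, `mem_ramificationGroup_of_pow_mem`, `not_dvd_relIndex_ramificationGroup` — the
  order of `G_i/G_r` is prime to the residue characteristic (ZS VI §12 (23)), via the inertial
  character `χ_σ` of `InertialCharacter2008` (`χ_{σ^p} = χ_σ^p` and `y ↦ y^p` injective on `κ(W)`);
* `isLocallyUniformizable_comap_algEquiv` — transport of local uniformizability along a
  `k`-isomorphism (the `iso` case of `Tower2008.Move3.hasLU`, isolated);
* `restrictScalars_mem_inertiaGroup_iff`, `restrictScalars_mem_ramificationGroup_iff` — base
  change `K ↦ M` for `G_i`, `G_r` (Lemma 6.1);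
* `descend_of_commutator_mem` — descent of local uniformization through an abelian segment
  `F ⊆ B ⊆ L^V`, `[Gal(L/F), Gal(L/F)] ≤ V`, all prime divisors of `(Gal(L/F) : V)` non-zero in
  `F`, by induction along Galois layers of prime degree (the mirror image of
  `TameSegment2008.CReach3.climb_of_commutator_mem`), each layer an instance of Lemma 9.4.

No dimension-specific input is used: transcendence degree `3` is only carried through the
hypotheses (`VState.Adm` and its inheritance lemmas `VState.Adm.up/down`). With
`TowerInheritance2008`/`Tower2008` this closes the last assembly node of the cell's DAG for
Cossart–Piltant 2008 §9 (pub-hironaka LEMMAS-CP A22 ⇐ A11, A20, A21): Prop 9.5 is reduced to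
its three leaves, of which Lemma 9.4 is in turn `tamePrimeDescent_of_viaStableModel`
(`TameDescent2008`). Nothing here contradicts or weakens a statement of [CossartPiltant2008]:
the three leaves remain cited statements used as hypotheses.

## Sources
- [CossartPiltant2008] V. Cossart, O. Piltant, Resolution of singularities of threefolds in
  positive characteristic I, J. Algebra 320 (2008) 1051–1082; HAL hal-00139124v1 (page and
  line references "HAL p." are to this version): Cor 6.3 (p. 20), Prop 9.3 (p. 27), Lemma 9.4
  (p. 29), Prop 9.5 and its proof (p. 30–31), §3.2 (8) (p. 6), Lemma 6.1 (p. 17).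
- [ZariskiSamuel1960] O. Zariski, P. Samuel, Commutative Algebra II, Van Nostrand 1960,
  Ch. VI §12 ((14''), (17), (23), Thm 24–25).
-/

noncomputable section

namespace Literature.AlgebraicGeometry.CossartPiltant200819.CP2008

open Literature.AlgebraicGeometry.Resolution IsLocalRing IntermediateField
open scoped Pointwise IntermediateField

universe u

section PrimeToP

variable {K L : Type u} [Field K] [Field L] [Algebra K L] [FiniteDimensional K L]
  (W : ValuationSubring L)

/-- `χ` does not depend on the name of the automorphism: transport along `σ = τ`. [folklore] -/
theorem chi_congr {σ τ : L ≃ₐ[K] L} (h : σ = τ) (hσ : σ ∈ inertiaGroup W)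
    (hτ : τ ∈ inertiaGroup W) (x : L) : chi W σ hσ x = chi W τ hτ x := by
  subst h
  rfl

/-- **`χ_{σⁿ} = χ_σⁿ`** (iterate of (14''): "`(a, st) = (a, s)(a, t)`").
[cite: ZariskiSamuel1960, Ch. VI §12 (14'')] -/
theorem chi_pow {σ : L ≃ₐ[K] L} (hσ : σ ∈ inertiaGroup W) {x : L} (hx : x ≠ 0) (n : ℕ) :
    chi W (σ ^ n) (pow_mem hσ n) x = chi W σ hσ x ^ n := by
  induction n with
  | zero =>
    rw [pow_zero (chi W σ hσ x)]
    exact (chi_congr W (pow_zero σ) (pow_mem hσ 0) (one_mem _) x).trans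
      (chi_eq_one_of_apply_eq W (one_mem _) hx rfl)
  | succ n ih =>
    rw [pow_succ (chi W σ hσ x) n, ← ih, ← chi_mul_left W (pow_mem hσ n) hσ x]
    exact chi_congr W (pow_succ σ n) _ _ x

/-- In the group `G_i/G_r` (the quotient of the inertia group by the ramification group, which is
normal since `G_i/G_r` is abelian) **no element has order `p`**, `p` the residue characteristic:
if `σ ∈ G_i` and `σ^p ∈ G_r` then `χ_σ^p = χ_{σ^p} ≡ 1`, so `χ_σ ≡ 1` (`y ↦ y^p` is injective on
`κ(W)`) and `σ ∈ G_r` (Zariski–Samuel VI §12 (23): "The order `e′₀` of `G_T/G_V` is prime to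
`π`"). [cite: ZariskiSamuel1960, Ch. VI §12, (17) and (23)] -/
theorem mem_ramificationGroup_of_pow_mem {p : ℕ} [Fact p.Prime] [CharP (ResidueField W) p]
    {σ : L ≃ₐ[K] L} (hσ : σ ∈ inertiaGroup W) (hp : σ ^ p ∈ ramificationGroup W) :
    σ ∈ ramificationGroup W := by
  haveI : ExpChar (ResidueField W) p := ExpChar.prime Fact.out
  refine (forall_chi_eq_one_iff W hσ).mp fun x hx => ?_
  have h1 : chi W σ hσ x ^ p = 1 := by
    rw [← chi_pow W hσ hx p]
    exact (forall_chi_eq_one_iff W (pow_mem hσ p)).mpr hp x hx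
  have h2 : chi W σ hσ x ^ (p ^ 1 * 1) = 1 := by rwa [pow_one, mul_one]
  rwa [ExpChar.pow_prime_pow_mul_eq_one_iff, pow_one] at h2

/-- **The order of `G_i/G_r` is prime to the residue characteristic** `p`: `p ∤ (G_i : G_r)`
(Zariski–Samuel VI §12 (23); Cossart–Piltant 2008 (8): "`K₀ʳ/K₀ⁱ` is an Abelian extension of order
prime to `p`").
[cite: ZariskiSamuel1960, Ch. VI §12, (23); CossartPiltant2008, §3.2 (8) (HAL p. 6)] -/
theorem not_dvd_relIndex_ramificationGroup {p : ℕ} [Fact p.Prime] [CharP (ResidueField W) p] :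
    ¬ p ∣ (ramificationGroup (K := K) W).relIndex (inertiaGroup W) := by
  classical
  intro hdvd
  set H : Subgroup (inertiaGroup (K := K) W) := (ramificationGroup W).subgroupOf (inertiaGroup W)
    with hH
  haveI hn : H.Normal := ⟨fun h hh g => by
    have hc : g * h * g⁻¹ * h⁻¹ ∈ H := by
      rw [hH, Subgroup.mem_subgroupOf]
      simp only [Subgroup.coe_mul, Subgroup.coe_inv]
      exact commutator_mem_ramificationGroup W g.2 h.2
    simpa using H.mul_mem hc hh⟩
  have hcard : p ∣ Nat.card ((inertiaGroup (K := K) W) ⧸ H) := by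
    rwa [← Subgroup.index_eq_card]
  obtain ⟨x, hx⟩ := exists_prime_orderOf_dvd_card' p hcard
  obtain ⟨g, rfl⟩ := QuotientGroup.mk_surjective x
  have hgp : g ^ p ∈ H := by
    rw [← QuotientGroup.eq_one_iff, QuotientGroup.mk_pow, ← hx, pow_orderOf_eq_one]
  have hg : (g : L ≃ₐ[K] L) ∈ ramificationGroup W := by
    refine mem_ramificationGroup_of_pow_mem W g.2 ?_
    have := (Subgroup.mem_subgroupOf).mp hgp
    simpa only [Subgroup.coe_pow] using this
  have hg1 : (QuotientGroup.mk g : (inertiaGroup (K := K) W) ⧸ H) = 1 :=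
    (QuotientGroup.eq_one_iff g).mpr (Subgroup.mem_subgroupOf.mpr hg)
  rw [hg1, orderOf_one] at hx
  exact (Fact.out : p.Prime).one_lt.ne' hx.symm

end PrimeToP

section Transport

/-- **Local uniformizability transports along a `k`-isomorphism** `e : K₁ ≃ K₂`:
`(K₂, O) ↦ (K₁, e⁻¹ O)`. [folklore] -/
theorem isLocallyUniformizable_comap_algEquiv {k K₁ K₂ : Type u} [Field k] [Field K₁]
    [Algebra k K₁] [Field K₂] [Algebra k K₂] (e : K₁ ≃ₐ[k] K₂) (O : ValuationSubring K₂)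
    (hs : IsLocallyUniformizable k K₂ O) :
    IsLocallyUniformizable k K₁ (O.comap (e : K₁ →+* K₂)) := by
  obtain ⟨A, hA, hfg, hfrac, hreg⟩ := hs
  exact isLocallyUniformizable_comap_of_model (e : K₁ →ₐ[k] K₂) O A hA
    (fun x _ => ⟨e.symm x, e.apply_symm_apply x⟩) hfg (fun z => by
      obtain ⟨a, b, hb, hab⟩ := IsFractionRing.div_surjective (A := A) (e z)
      refine ⟨a, b, a.2, b.2, ?_, hab.symm⟩
      have hb0 : b ≠ 0 := nonZeroDivisors.ne_zero hb
      exact fun h => hb0 (Subtype.ext h)) hreg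

variable {K L : Type u} [Field K] [Field L] [Algebra K L] (W : ValuationSubring L)

/-- Base change of the inertia group: `σ ∈ G_i(W | W ∩ M)` iff `σ|_K ∈ G_i(W | W ∩ K)` — the
defining conditions (`σ W = W`, `σ` trivial on `κ(W)`) do not see the base (Cossart–Piltant 2008,
Lemma 6.1 (1)). [cite: CossartPiltant2008, Lemma 6.1 (HAL p. 17)] -/
theorem restrictScalars_mem_inertiaGroup_iff (M : IntermediateField K L) (σ : L ≃ₐ[M] L) :
    σ.restrictScalars K ∈ inertiaGroup (K := K) W ↔ σ ∈ inertiaGroup (K := M) W := by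
  have hsmul : σ.restrictScalars K • W = σ • W := by
    ext x
    rw [ValuationSubring.mem_smul_pointwise_iff_exists,
      ValuationSubring.mem_smul_pointwise_iff_exists]
    exact Iff.rfl
  rw [mem_inertiaGroup_iff', mem_inertiaGroup_iff', hsmul]
  exact Iff.rfl

/-- Base change of the ramification group (same remark). [cite: CossartPiltant2008, Lemma 6.1
(HAL p. 17)] -/
theorem restrictScalars_mem_ramificationGroup_iff (M : IntermediateField K L) (σ : L ≃ₐ[M] L) :
    σ.restrictScalars K ∈ ramificationGroup (K := K) W ↔ σ ∈ ramificationGroup (K := M) W := by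
  rw [mem_ramificationGroup_iff, mem_ramificationGroup_iff]
  exact Iff.rfl

end Transport

section Layers

variable {k : Type u} [Field k]

/-- **Descent through an abelian segment of tame layers** (the middle step of the proof of
Prop 9.5, HAL p. 30–31: "`K″/Kⁱ` is a tower of Galois extensions of prime degree `l ≠ p` …
apply Lemma 9.4 `[K″ : Kⁱ]` times"), PROVED from Lemma 9.4 as a hypothesis: `L/F` finite Galois,
`V ≤ Gal(L/F)` containing all commutators, every prime dividing `(Gal(L/F) : V)` non-zero in
`F`, `W` an admissible valuation ring of `L` over `k`; if `W ∩ B` is locally uniformizable for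
some `B ⊆ L^V` then so is `W ∩ F` — by induction along `F = B⁽⁰⁾ ⊂ ⋯ ⊂ B`, Galois layers of
prime degree. [cite: CossartPiltant2008, Prop 9.5 proof (HAL p. 30–31)] -/
theorem descend_of_commutator_mem (h94 : TamePrimeDescent.{u}) {F L : Type u} [Field F]
    [Algebra k F] [Field L] [Algebra F L] [Algebra k L] [IsScalarTower k F L]
    [FiniteDimensional F L] [IsGalois F L]
    (V : Subgroup (L ≃ₐ[F] L)) (hcomm : ∀ a b : L ≃ₐ[F] L, a * b * a⁻¹ * b⁻¹ ∈ V)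
    (hchar : ∀ ℓ : ℕ, ℓ.Prime → ℓ ∣ V.index → (ℓ : F) ≠ 0)
    (W : ValuationSubring L) (hkW : ∀ c : k, algebraMap k L c ∈ W)
    (hadm : VState.Adm ⟨L, W, hkW⟩) :
    ∀ B : IntermediateField F L, B ≤ fixedField V →
      IsLocallyUniformizable k B (W.comap (algebraMap B L)) →
      IsLocallyUniformizable k F (W.comap (algebraMap F L)) := by
  suffices hmain : ∀ (n : ℕ) (B : IntermediateField F L), B ≤ fixedField V →
      B.fixingSubgroup.index = n →
      IsLocallyUniformizable k B (W.comap (algebraMap B L)) →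
      IsLocallyUniformizable k F (W.comap (algebraMap F L)) from
    fun B hB hLU => hmain _ B hB rfl hLU
  intro n
  induction n using Nat.strong_induction_on with
  | _ n ih =>
  intro B hB hn hLU
  by_cases htop : B.fixingSubgroup = ⊤
  · have hB0 : B = ⊥ := by
      rw [← IsGalois.fixedField_fixingSubgroup B, htop, IsGalois.fixedField_top]
    subst hB0
    haveI : IsScalarTower k F (⊥ : IntermediateField F L) := IsScalarTower.of_algebraMap_eq
      fun c => Subtype.ext (by
        change algebraMap k L c = algebraMap F L (algebraMap k F c)
        exact IsScalarTower.algebraMap_apply k F L c)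
    let e : F ≃ₐ[k] (⊥ : IntermediateField F L) :=
      ((IntermediateField.botEquiv F L).restrictScalars k).symm
    have h := isLocallyUniformizable_comap_algEquiv e _ hLU
    have hO : (W.comap (algebraMap (⊥ : IntermediateField F L) L)).comap
        (e : F →+* (⊥ : IntermediateField F L)) = W.comap (algebraMap F L) := by
      ext x
      simp only [ValuationSubring.mem_comap, RingHom.coe_coe]
      have hx : algebraMap (⊥ : IntermediateField F L) L (e x) = algebraMap F L x := by
        change (((IntermediateField.botEquiv F L).symm x : (⊥ : IntermediateField F L)) : L) = _
        rw [IntermediateField.botEquiv_symm]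
        rfl
      rw [hx]
    rwa [hO] at h
  -- `H := Gal(L/B) ⊇ V ⊇ [G, G]`: a subgroup `N ⊇ H` with `(N : H) = ℓ` prime; `B₁ := L^N ⊆ B`
  have hVH : V ≤ B.fixingSubgroup := (IntermediateField.le_iff_le V B).mp hB
  obtain ⟨N, hHN, hℓ⟩ := exists_le_prime_index_of_commutator_mem htop fun a b => hVH (hcomm a b)
  set ℓ := (B.fixingSubgroup.subgroupOf N).index with hℓdef
  set B₁ : IntermediateField F L := fixedField N with hB₁
  have hNB₁ : B₁.fixingSubgroup = N := fixingSubgroup_fixedField N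
  have hle : B₁ ≤ B := fun x hx => by
    have hx' : x ∈ fixedField B.fixingSubgroup :=
      (mem_fixedField_iff _ x).mpr fun σ hσ => (mem_fixedField_iff _ x).mp hx σ (hHN hσ)
    rwa [IsGalois.fixedField_fixingSubgroup] at hx'
  have hlt : B₁.fixingSubgroup.index < n := by
    rw [hNB₁, ← hn, ← Subgroup.relIndex_mul_index hHN]
    change N.index < ℓ * N.index
    have hpos : 0 < N.index := Nat.pos_of_ne_zero Subgroup.FiniteIndex.index_ne_zero
    have h2 := hℓ.two_le
    nlinarith
  haveI : IsScalarTower k B₁ L := isScalarTower_intermediateField' (k := k) B₁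
  -- the layer `B₁ ⊆ B`: Galois of prime degree `ℓ`, `ℓ ≠ p`
  have hcardN : Nat.card N = ℓ * Nat.card B.fixingSubgroup := by
    have h1 := (B.fixingSubgroup.subgroupOf N).index_mul_card
    rw [Nat.card_congr (Subgroup.subgroupOfEquivOfLe hHN).toEquiv] at h1
    exact h1.symm
  have hdeg : Module.finrank B₁ (extendScalars hle) = ℓ := by
    have htower := Module.finrank_mul_finrank B₁ (extendScalars hle) L
    have hxL : Module.finrank (extendScalars hle) L = Nat.card B.fixingSubgroup :=
      finrank_eq_card_fixingSubgroup B
    have hB₁L : Module.finrank B₁ L = Nat.card N := by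
      rw [hB₁]
      exact finrank_fixedField_eq_card N
    rw [hxL, hB₁L, hcardN] at htower
    exact Nat.eq_of_mul_eq_mul_right Nat.card_pos htower
  have hprime : (Module.finrank B₁ (extendScalars hle)).Prime := hdeg ▸ hℓ
  have hHn : B.fixingSubgroup.Normal :=
    ⟨fun h hh g => by simpa using B.fixingSubgroup.mul_mem (hVH (hcomm g h)) hh⟩
  have hnormal : Normal B₁ (extendScalars hle) := by
    rw [IntermediateField.normal_iff_forall_map_le']
    rintro σ _ ⟨x, hx, rfl⟩
    have hxB : (x : L) ∈ B := hx
    change σ x ∈ B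
    rw [← IsGalois.fixedField_fixingSubgroup B, mem_fixedField_iff]
    intro h hh
    have hc : (σ.restrictScalars F)⁻¹ * h * (σ.restrictScalars F) ∈ B.fixingSubgroup := by
      have := hHn.conj_mem h hh (σ.restrictScalars F)⁻¹
      simpa using this
    have hfix := (IntermediateField.mem_fixingSubgroup_iff _ _).mp hc x hxB
    have : h (σ x) =
        (σ.restrictScalars F) (((σ.restrictScalars F)⁻¹ * h * σ.restrictScalars F) x) := by
      simp [AlgEquiv.mul_apply, AlgEquiv.aut_inv]
    rw [this, hfix]
    rfl
  have hgalE : IsGalois B₁ (extendScalars hle) := by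
    haveI : Algebra.IsSeparable B₁ (extendScalars hle) :=
      Algebra.isSeparable_tower_bot_of_isSeparable B₁ (extendScalars hle) L
    haveI := hnormal
    exact isGalois_iff.mpr ⟨inferInstance, inferInstance⟩
  have hdvd : ℓ ∣ V.index := by
    have h1 : B.fixingSubgroup.relIndex N * N.index = B.fixingSubgroup.index :=
      Subgroup.relIndex_mul_index hHN
    have h2 : B.fixingSubgroup.index ∣ V.index := Subgroup.index_dvd_of_le hVH
    exact dvd_trans (Dvd.intro _ h1) h2
  have hchar' : ((Module.finrank B₁ (extendScalars hle) : ℕ) : B₁) ≠ 0 := by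
    rw [hdeg]
    intro h0
    apply hchar ℓ hℓ hdvd
    have h1 : algebraMap F B₁ (ℓ : F) = 0 := by rw [map_natCast]; exact h0
    exact (map_eq_zero_iff _ (algebraMap F B₁).injective).mp h1
  -- admissibility of the stages `(B₁, W ∩ B₁)` and `(B, W ∩ B)`
  haveI : IsScalarTower k (extendScalars hle) L :=
    isScalarTower_intermediateField' (k := k) (K := B₁) (extendScalars hle)
  obtain ⟨hfg₁, h3₁, -, -⟩ := VState.Adm.down (K := B₁) W hkW hadm
  obtain ⟨-, -, h1E, halgE⟩ := VState.Adm.down (K := extendScalars hle) W hkW hadm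
  have hLUE : IsLocallyUniformizable k (extendScalars hle)
      (W.comap (algebraMap (extendScalars hle) L)) := hLU
  -- Lemma 9.4 on the layer, then the induction hypothesis
  have step := h94 k B₁ hfg₁ h3₁ (extendScalars hle) inferInstance hgalE hprime hchar'
    (W.comap (algebraMap (extendScalars hle) L))
    (forall_algebraMap_mem_comap_intermediateField hkW (extendScalars hle)) h1E halgE hLUE
  rw [comap_comap_algebraMap (extendScalars hle) W] at step
  exact ih _ hlt B₁ (le_trans hle hB) rfl step

end Layers

/-! ### Proposition 9.5 from Corollary 6.3, Proposition 9.3 and Lemma 9.4 -/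

/-- **Cossart–Piltant 2008, Prop 9.5 ⇐ Cor 6.3 + Prop 9.3 + Lemma 9.4** — the bookkeeping of
the printed proof (HAL p. 30–31), PROVED with the three results as hypotheses: given `K' ⊆ Kʳ`
with `W ∩ K'` locally uniformizable, (1) climb from `K'` to `K″ := K'·Kⁱ`, which lies below the
inertia field of `W` over `W ∩ K'` (Cor 6.3 over the base `K'`: an inertial `K'`-automorphism
is an inertial `K`-automorphism fixing `K'`, hence fixes `Kⁱ`); (2) descend from `K″ ⊆ Kʳ` to
`Kⁱ` through the abelian extension `Kʳ/Kⁱ`, of order prime to `p` (Zariski–Samuel VI §12 (23),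
here `not_dvd_relIndex_ramificationGroup`), along Galois layers of prime degree `l ≠ p`
(Lemma 9.4, `descend_of_commutator_mem`); (3) descend from `Kⁱ` to `K` (Prop 9.3). No
dimension-specific input enters besides the hypotheses. [cite: CossartPiltant2008, Prop 9.5
proof (HAL p. 30–31)] -/
theorem descentBelowRamificationField_of_leaves (h63 : ClimbToInertiaField.{u})
    (h93 : DescentBelowInertiaField.{u}) (h94 : TamePrimeDescent.{u}) :
    DescentBelowRamificationField.{u} := by
  intro k K _ _ _ hfg h3 L _ _ _ _ hfin hgal W hk h1 halg K' hK' hLU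
  haveI := hfin
  haveI := hgal
  have hadmL : VState.Adm ⟨L, W, hk⟩ :=
    ⟨intermediateField_fg_top_of_finite hfg, (trdeg_eq_of_isAlgebraic' (K := K) (L := L)).trans h3,
      h1, halg⟩
  set Gi := inertiaGroup (K := K) W with hGi
  set Gr := ramificationGroup (K := K) W with hGr
  set F₀ : IntermediateField K L := fixedField Gi with hF₀
  set K2 : IntermediateField K L := K' ⊔ F₀ with hK2
  -- (1) climb from `K'` to `K2 = K'·Kⁱ` (Cor 6.3 over the base `K'`)
  haveI : IsScalarTower k K' L := isScalarTower_intermediateField' (k := k) K'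
  obtain ⟨hfg', h3', -, -⟩ := VState.Adm.down (K := K') W hk hadmL
  have hle' : K' ≤ K2 := le_sup_left
  have hinert : LeInertiaField K' W (extendScalars hle') := by
    intro σ hσ x hx
    have hσ' : σ.restrictScalars K ∈ Gi :=
      (restrictScalars_mem_inertiaGroup_iff W K' σ).mpr ((mem_inertiaGroup_iff W σ).mpr hσ)
    have hK'le : K' ≤ fixedField (Subgroup.zpowers (σ.restrictScalars K)) := by
      rw [IntermediateField.le_iff_le, Subgroup.zpowers_le,
        IntermediateField.mem_fixingSubgroup_iff]
      intro y hy
      exact σ.commutes ⟨y, hy⟩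
    have hF₀le : F₀ ≤ fixedField (Subgroup.zpowers (σ.restrictScalars K)) := by
      rw [IntermediateField.le_iff_le, Subgroup.zpowers_le, hF₀, fixingSubgroup_fixedField]
      exact hσ'
    have hxK2 : x ∈ K2 := hx
    exact (mem_fixedField_iff _ x).mp (sup_le hK'le hF₀le hxK2) (σ.restrictScalars K)
      (Subgroup.mem_zpowers _)
  have hLU2 : IsLocallyUniformizable k (extendScalars hle')
      (W.comap (algebraMap (extendScalars hle') L)) :=
    h63 k K' hfg' h3' L inferInstance inferInstance W hk (extendScalars hle') hinert hLU
  -- (2) descend from `K″ ⊆ Kʳ` to `Kⁱ` (Lemma 9.4 along the layers of `Kʳ/Kⁱ`)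
  haveI : IsScalarTower k F₀ L := isScalarTower_intermediateField' (k := k) F₀
  have hle₀ : F₀ ≤ K2 := le_sup_right
  have hGiF : ∀ σ : L ≃ₐ[F₀] L, σ ∈ inertiaGroup (K := F₀) W := fun σ => by
    refine (restrictScalars_mem_inertiaGroup_iff W F₀ σ).mp ?_
    have hfix : σ.restrictScalars K ∈ F₀.fixingSubgroup :=
      (IntermediateField.mem_fixingSubgroup_iff _ _).mpr fun y hy => σ.commutes ⟨y, hy⟩
    have hGT : F₀.fixingSubgroup = Gi := fixingSubgroup_fixedField Gi
    rwa [hGT] at hfix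
  have htop : inertiaGroup (K := F₀) W = ⊤ := eq_top_iff.mpr fun σ _ => hGiF σ
  have hcomm : ∀ a b : L ≃ₐ[F₀] L, a * b * a⁻¹ * b⁻¹ ∈ ramificationGroup (K := F₀) W :=
    fun a b => commutator_mem_ramificationGroup W (hGiF a) (hGiF b)
  have hchar : ∀ ℓ : ℕ, ℓ.Prime → ℓ ∣ (ramificationGroup (K := F₀) W).index → (ℓ : F₀) ≠ 0 := by
    intro ℓ hℓ hdvd h0
    have hk0 : (ℓ : k) = 0 := by
      have h1' : algebraMap k F₀ (ℓ : k) = 0 := by rw [map_natCast]; exact h0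
      exact (map_eq_zero_iff _ (algebraMap k F₀).injective).mp h1'
    haveI : Fact ℓ.Prime := ⟨hℓ⟩
    haveI : CharP k ℓ := (CharP.charP_iff_prime_eq_zero hℓ).mpr hk0
    haveI : CharP (ResidueField W) ℓ := charP_residueField ℓ W hk
    apply not_dvd_relIndex_ramificationGroup (K := F₀) W (p := ℓ)
    rwa [htop, Subgroup.relIndex_top_right]
  have hK2r : K2 ≤ fixedField Gr := by
    refine sup_le (fun y hy => ?_) (fixedField_inertiaGroup_le W)
    rw [mem_fixedField_iff]
    intro σ hσ
    exact hK' σ ⟨(mem_inertiaGroup_iff W σ).mp (ramificationGroup_le_inertiaGroup W hσ),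
      (mem_ramificationGroup_iff W σ).mp hσ⟩ y hy
  have hB : extendScalars hle₀ ≤ fixedField (ramificationGroup (K := F₀) W) := by
    intro x hx
    have hxK2 : (x : L) ∈ K2 := hx
    rw [mem_fixedField_iff]
    intro τ hτ
    exact (mem_fixedField_iff _ _).mp (hK2r hxK2) _
      ((restrictScalars_mem_ramificationGroup_iff W F₀ τ).mpr hτ)
  have hLU2' : IsLocallyUniformizable k (extendScalars hle₀)
      (W.comap (algebraMap (extendScalars hle₀) L)) := hLU2
  have hLU₀ : IsLocallyUniformizable k F₀ (W.comap (algebraMap F₀ L)) :=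
    descend_of_commutator_mem h94 (ramificationGroup (K := F₀) W) hcomm hchar W hk hadmL
      (extendScalars hle₀) hB hLU2'
  -- (3) descend from `Kⁱ` to `K` (Prop 9.3)
  have hinert₀ : LeInertiaField K W F₀ := fun σ hσ x hx =>
    (mem_fixedField_iff _ x).mp hx σ ((mem_inertiaGroup_iff W σ).mpr hσ)
  obtain ⟨S₀, hS₀⟩ := exists_isLocalUniformizationOf _ hLU₀
  obtain ⟨S, -, -, R, hR, -⟩ := h93 k K hfg h3 L hfin hgal W hk h1 halg F₀ hinert₀ S₀ hS₀
  exact hR.isLocallyUniformizable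

/-- **Theorem 7.2 from Cor 6.3, Prop 8.3, Prop 9.3 and Lemma 9.4** (the four printed leaves of
§§6–9; Prop 9.5 assembled by `descentBelowRamificationField_of_leaves`, the tower by
`TameLayers2008.reductionToArtinSchreier_of_leaves`).
[cite: CossartPiltant2008, Thm 7.2 (HAL pp. 19–21) and Prop 9.5 (HAL p. 30–31)] -/
theorem reductionToArtinSchreier_of_leaves' (h63 : ClimbToInertiaField.{u})
    (h83 : PrimeDegreeAscent.{u}) (h93 : DescentBelowInertiaField.{u})
    (h94 : TamePrimeDescent.{u}) : ReductionToArtinSchreier.{u} :=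
  reductionToArtinSchreier_of_leaves h63 h83 (descentBelowRamificationField_of_leaves h63 h93 h94)

/-- **`LU3DiffFinite` from Prop 5.1, Cor 6.3, Prop 8.3, Prop 9.3, Lemma 9.4 and [CP-II].**
[cite: CossartPiltant2008, Thm 7.2 + Section 2; CossartPiltant2009, Thm on p. 1839] -/
theorem lu3DiffFinite_of_leaves' (p51 : RankReduction.{u}) (h63 : ClimbToInertiaField.{u})
    (h83 : PrimeDegreeAscent.{u}) (h93 : DescentBelowInertiaField.{u})
    (h94 : TamePrimeDescent.{u}) (cp2 : CossartPiltant2009Main.{u}) : LU3DiffFinite.{u} :=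
  lu3DiffFinite_of_leaves p51 h63 h83 (descentBelowRamificationField_of_leaves h63 h93 h94) cp2

/-- **Prop 9.5 with the tame step read as printed** (`TameDescent2008`): Cor 6.3, Prop 9.3, the
printed proof of Lemma 9.4 (`TamePrimeDescentViaStableModel`) and the stability hypothesis
(S3\*) it consumes at every normal local model `R₀` (`GStableUniformizationAbove`, made an
explicit binder by `tamePrimeDescent_of_viaStableModel`) give `DescentBelowRamificationField`.
This only composes `descentBelowRamificationField_of_leaves` with
`tamePrimeDescent_of_viaStableModel`; it records at node Prop 9.5 where the printed argument
uses (S3\*). [cite: CossartPiltant2008, Prop 9.5 (HAL p. 30–31) and Lemma 9.4 (HAL p. 30)] -/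
theorem descentBelowRamificationField_of_viaStableModel (h63 : ClimbToInertiaField.{u})
    (h93 : DescentBelowInertiaField.{u}) (h₁ : TamePrimeDescentViaStableModel.{u})
    (h₂ : ∀ (k K : Type u) [Field k] [Field K] [Algebra k K], (⊤ : IntermediateField k K).FG →
      Algebra.trdeg k K = 3 →
      ∀ (L : Type u) [Field L] [Algebra K L] [Algebra k L] [IsScalarTower k K L],
        FiniteDimensional K L → IsGalois K L →
        (Module.finrank K L).Prime → ((Module.finrank K L : ℕ) : K) ≠ 0 →
        ∀ (W : ValuationSubring L) (hk : ∀ c : k, algebraMap k L c ∈ W),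
          Nonempty W.valuation.RankOne → residueTrdeg k W hk = 0 →
            IsLocallyUniformizable k L W →
            ∀ R₀ : Subalgebra k K, IsNormalLocalModelOf k K (W.comap (algebraMap K L)) R₀ →
              GStableUniformizationAbove (K := K) W R₀) :
    DescentBelowRamificationField.{u} :=
  descentBelowRamificationField_of_leaves h63 h93 (tamePrimeDescent_of_viaStableModel h₁ h₂)

end Literature.AlgebraicGeometry.CossartPiltant200819.CP2008

end
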